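import Mathlib
import Literature.Combinatorics.Optimization.PairwiseIndependenceSheraliAdamsGap
import HarnessLib

/-!
# Sherali–Adams SDP (`SA₊`) solutions from pairwise independence
# (Benabbas–Georgiou–Magen–Tulsiani 2012, the SDP half of Theorem 4.3: Lemma 2.3, Claim 3.4,
# Claim 4.4; Georgiou's thesis §3.2 (3.32), §8.5)

[topic Combinatorics/Optimization]

`ExpandingCspLocalDistributions.lean` / `PairwiseIndependenceSheraliAdamsGap.lean` prove the
Sherali–Adams (LP) half of [BenabbasGeorgiouMagenTulsiani2012] Thm 4.3 (= Kothari–Meka–Raghavendra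
Thm 1.4).  The printed theorem is about the stronger **Sherali–Adams SDP hierarchy** (`SA₊`, the
"mixed hierarchy": level-`t` Sherali–Adams variables `X_(S,α)` plus vectors).  The SDP constraints
([Georgiou2010] Example 3.2.13, eq. (3.32), the system studied in his Chapter 8 = [BGMT12] §2.3,
Figure 1):

> `v_(i₁,j₁) · v_(i₂,j₂) = X_({i₁,i₂},(j₁,j₂))` for all `i₁ ≠ i₂ ∈ [n]`, `j₁, j₂ ∈ [q]`;
> `v_(i,j₁) · v_(i,j₂) = 0` for all `i ∈ [n]`, `j₁ ≠ j₂ ∈ [q]`;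
> `‖v_(i,j)‖² = v_(i,j) · v_0 = X_({i},j)` for all `i ∈ [n]`, `j ∈ [q]`;  `‖v_0‖² = X_(∅,∅) = 1`.

> **[BGMT12] Lemma 2.3.** "Consider a family `{D(S)}_{S⊆[n]:|S|≤t}` of distributions, where each
> `D(S)` is defined over `[q]^S`. Suppose that for every `S ⊆ T ⊆ [n]` with `|T| ≤ t`, the
> distributions `D(S), D(T)` are equal on `S` and there exists a set `v_(i,j)` … of vectors and a unit
> vector `v_0` satisfying [the constraints above with `X_(S,α) = Pr_{D(S)}[α]`]. Then the vectors
> together with the LP variables `X_(S,α) = Pr_{D(S)}[α]` form a feasible solution to the program in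
> Figure 1."
>
> **Proof of Thm 4.3 (SDP part).** "… Also, Claim 3.4 implies that `P_µ(S)` hence `D(S)` is
> pairwise-independent and balanced for any `S`. We can now construct the SDP vectors with inner
> products agreeing with the probabilities according to the distributions `D(S) = P_µ(S̄)` … using the
> following simple fact.  **Claim 4.4.** There exist vectors `{v_(i,j)}` and `v_0` satisfying:
> [`‖v_0‖ = 1`, `v_0 · v_(i,j) = 1/q`, `v_(i,j₁)·v_(i,j₂) = [j₁ = j₂]/q`,
> `v_(i₁,j₁) · v_(i₂,j₂) = 1/q²` for `i₁ ≠ i₂`]."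

Claim 3.4 (pairwise independence of `P_µ(S)`) is where hypothesis (3) of the instance — "no two
constraints share more than one variable" ([BGMT12] §4, first paragraph; [Georgiou2010] Lemma 8.5.1
(3)) — is used: it makes the constraint graph expand even after deleting a pair `{i,j}` of variables.

This file PROVES, for `q = 2` (the tree's alphabet; `-- TODO(general form): alphabet [q]`):

* `SAPlusSolution n t` — the level-`t` `SA₊` solution of a Boolean Max-CSP: the consistent local
  distributions of the tree (`LocalExpectations n t`, CMM Lemma 2.1 currency; the LP variables are
  `X_(S,α) = Pr_{D(S)}[α]`) together with a positive semidefinite Gram matrix on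
  `{0} ∪ ([n] × {0,1})` satisfying (3.32): `Y(0,0) = 1`, `Y(0,(i,a)) = Pr_{D({i})}[x_i = a]`,
  `Y((i,a),(j,c)) = Pr_{D({i,j})}[x_i = a ∧ x_j = c]` (for `i = j` this is `[a = c]·Pr[x_i = a]`, i.e.
  the printed `‖v_(i,j)‖² = X_({i},j)` and orthogonality).
* `SAPlus.unifMoment`, `unifMoment_posSemidef`, `SAPlusSolution.ofUniformPairs` — **Claim 4.4 +
  Lemma 2.3**: the second-moment matrix `E_x[z(x) z(x)ᵀ]` of the indicator vector
  `z(x) = (1, [x_i = a])_{i,a}` under the UNIFORM distribution on `{0,1}ⁿ` is positive semidefinite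
  (`(2^{−n}) · BᴴB`), and it completes any consistent family whose distributions on the sets of size
  `≤ 2` are uniform to an `SA₊` solution.
* `PairwiseIndependence.expandsOff_pair` — expansion of `G|_{−S}` for `|S| ≤ 2` from
  `(r, k − 9/4)`-boundary expansion of `G` and hypothesis (3): every family of `≤ r` constraints `F`
  has `|∂F ∖ S| ≥ (k − 35/12)|F|` (`|F| = 1`: `|∂F| = k`; `|F| = 2`: `|∂F| ≥ 2k − 2` by (3);
  `|F| ≥ 3`: `(k − 9/4)|F| − 2 ≥ (k − 35/12)|F|`).
* `PairwiseIndependence.pE_eq_uniform_of_card_le_two` — **Claim 3.4** ("`P_µ(S)` is a balanced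
  pairwise independent distribution"): for `|S| ≤ 2`, `S ⊆ W`, `|𝒞(W)| ≤ r`, the local expectation
  `E_{P_µ(W)} F(x|_S)` is the uniform average `2^{−n} Σ_x F(x|_S)` — Lemma 8.4.2
  (`sum_mul_wt_eq`) with `S₁ = S`, which dominates no constraint.
* `PairwiseIndependence.exists_localExpectations_dom` — the construction of Lemma 8.5.2
  (`exists_localExpectations`, same proof) exporting in addition that the advice set `S̄` dominates at
  most `r` constraints (needed to apply Lemma 8.4.2 at `S̄`).
* **`PairwiseIndependence.exists_saPlusSolution_lits`** — the SDP half of Thm 4.3 for ONE instance: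
  scopes `e_i(Fin k)` (`k ≥ 3`) pairwise meeting in `≤ 1` variable, negation patterns `p_i`, a balanced
  pairwise independent `µ`, `G` `(r, k − 9/4)`-boundary expanding, `k ≤ d`, `16kd ≤ r`: there is a
  level-`d` `SA₊` solution giving value `1` to every `T_i`-junta equal to `1` on `{µ_i ≠ 0}` (so to
  every constraint of a promising predicate supported by `µ`).

The random instances with property (3) and the resulting `SA₊` gap theorem are the business of a
sequel.  Everything here is proved; no named facts; no `sorry`.

## References

* [BenabbasGeorgiouMagenTulsiani2012] S. Benabbas, K. Georgiou, A. Magen, M. Tulsiani, *SDP gaps from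
  pairwise independence*, Theory of Computing 8 (2012) 269–289, §2.3 (the Sherali–Adams SDP
  hierarchy, Lemma 2.3), Claim 3.4, §4 (hypothesis (3), Claim 4.2, Thm 4.3, Claim 4.4).  Held text
  `paper:doi-10-4086-toc-2012-v008a012` (pp. 7, 13).
* [Georgiou2010] K. Georgiou, *Integrality gaps for strong linear programming and semidefinite
  programming relaxations*, PhD thesis, Toronto 2010: Def. 3.2.11 and Example 3.2.13 with eq. (3.32)
  (p. 76–77 of the held text `paper:w2511322911`), Lemma 8.4.2, Lemma 8.5.1 (3), Thm 8.5.3.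
* [KothariMekaRaghavendra2017] Thm 1.4 (the Sherali–Adams half, proved in
  `PairwiseIndependenceSheraliAdamsGap.lean`).
-/

noncomputable section

open Finset Matrix

namespace Literature.Combinatorics.Optimization

variable {n : ℕ}

/-! ### The Sherali–Adams SDP (`SA₊`) relaxation of a Boolean Max-CSP -/

/-- **A level-`t` Sherali–Adams SDP (`SA₊`) solution** (BGMT Figure 1 / Georgiou (3.32), `q = 2`):
consistent local distributions `D(S)` on all `|S| ≤ t` (the LP variables `X_(S,α) = Pr_{D(S)}[α]`)
and vectors `v_0, v_(i,a)` — carried as their positive semidefinite Gram matrix `Y` on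
`{0} ∪ ([n] × {0,1})` — with `‖v_0‖² = 1`, `v_0 · v_(i,a) = Pr_{D({i})}[x_i = a]`, and
`v_(i,a) · v_(j,c) = Pr_{D({i,j})}[x_i = a ∧ x_j = c]` (for `i = j`: `‖v_(i,a)‖² = Pr[x_i = a]` and
`v_(i,a) · v_(i,c) = 0` for `a ≠ c`).
[cite: BenabbasGeorgiouMagenTulsiani2012, §2.3 and Lemma 2.3 (p. 7)] [cite: Georgiou2010, Example 3.2.13, eq. (3.32) (p. 76–77)] -/
structure SAPlusSolution (n t : ℕ) extends LocalExpectations n t where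
  /-- the Gram matrix of `v_0` (index `none`) and the `v_(i,a)` (index `some (i,a)`) -/
  Y : Matrix (Option (Fin n × Bool)) (Option (Fin n × Bool)) ℝ
  /-- the vectors exist: the Gram matrix is positive semidefinite -/
  psd : Y.PosSemidef
  /-- `‖v_0‖² = X_(∅,∅) = 1` -/
  norm_v0 : Y none none = 1
  /-- `v_0 · v_(i,a) = X_({i},a)` -/
  v0_inner : ∀ (i : Fin n) (a : Bool),
    Y none (some (i, a)) = L {i} (fun b => if b ⟨i, mem_singleton_self i⟩ = a then 1 else 0)
  /-- `v_(i,a) · v_(j,c) = X_({i,j},(a,c))` -/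
  inner : ∀ (i j : Fin n) (a c : Bool),
    Y (some (i, a)) (some (j, c)) =
      L {i, j} (fun b => if b ⟨i, mem_insert_self i {j}⟩ = a ∧
        b ⟨j, mem_insert_of_mem (mem_singleton_self j)⟩ = c then 1 else 0)

namespace SAPlusSolution

variable {t : ℕ} (Λ : SAPlusSolution n t)

/-- The Gram matrix is symmetric. [cite: Georgiou2010, eq. (3.32) (p. 77)] -/
theorem Y_symm (p q : Option (Fin n × Bool)) : Λ.Y p q = Λ.Y q p := by
  have h := Λ.psd.1
  have := congrFun (congrFun h p) q
  simpa [conjTranspose_apply] using this.symm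

/-- `v_(i,a) · v_0 = X_({i},a)` as well. [cite: Georgiou2010, eq. (3.32) (p. 77)] -/
theorem inner_v0 (i : Fin n) (a : Bool) :
    Λ.Y (some (i, a)) none = Λ.L {i} (fun b => if b ⟨i, mem_singleton_self i⟩ = a then 1 else 0) := by
  rw [Λ.Y_symm, Λ.v0_inner]

end SAPlusSolution

/-! ### Claim 4.4 and Lemma 2.3: the vectors for pairwise-uniform local distributions -/

namespace SAPlus

/-- The indicator coordinates `z_0(x) = 1`, `z_(i,a)(x) = [x_i = a]` of an assignment (the integral
`SA₊` vectors). [cite: BenabbasGeorgiouMagenTulsiani2012, §2.3 (p. 7: "The intended solution")] -/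
def indVec (x : Fin n → Bool) : Option (Fin n × Bool) → ℝ
  | none => 1
  | some (i, a) => if x i = a then 1 else 0

/-- The matrix `B(x, p) = z_p(x)`. [cite: BenabbasGeorgiouMagenTulsiani2012, Claim 4.4 (p. 13)] -/
def indMat (n : ℕ) : Matrix (Fin n → Bool) (Option (Fin n × Bool)) ℝ := fun x p => indVec x p

/-- **The Gram matrix of Claim 4.4**: the second moments `E_x[z_p(x) z_q(x)]` under the uniform
distribution on `{0,1}ⁿ`, i.e. `2^{−n} · BᴴB` (entries `1`, `1/2`, `[a = c]/2`, `1/4` — the printed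
inner products `1`, `1/q`, `[j₁ = j₂]/q`, `1/q²`).
[cite: BenabbasGeorgiouMagenTulsiani2012, Claim 4.4 (p. 13)] -/
def unifMoment (n : ℕ) : Matrix (Option (Fin n × Bool)) (Option (Fin n × Bool)) ℝ :=
  ((2⁻¹ : ℝ) ^ n) • ((indMat n)ᴴ * indMat n)

/-- Entries of the Gram matrix. [cite: BenabbasGeorgiouMagenTulsiani2012, Claim 4.4 (p. 13)] -/
theorem unifMoment_apply (p q : Option (Fin n × Bool)) :
    unifMoment n p q = (2⁻¹ : ℝ) ^ n * ∑ x : Fin n → Bool, indVec x p * indVec x q := by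
  simp [unifMoment, Matrix.mul_apply, indMat]

/-- **Claim 4.4: the vectors exist** — the Gram matrix is positive semidefinite (`2^{−n}·BᴴB ⪰ 0`).
[cite: BenabbasGeorgiouMagenTulsiani2012, Claim 4.4 (p. 13)] -/
theorem unifMoment_posSemidef : (unifMoment n).PosSemidef :=
  (Matrix.posSemidef_conjTranspose_mul_self (indMat n)).smul (by positivity)

end SAPlus

namespace SAPlusSolution

open SAPlus

/-- **Lemma 2.3 with Claim 4.4**: a consistent family of local distributions whose distributions on
the sets of size `≤ 2` are UNIFORM (`E_{D(S)} F = 2^{−n} Σ_x F(x|_S)`, "pairwise-independent and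
balanced") is completed to a level-`t` `SA₊` solution by the vectors of Claim 4.4.
[cite: BenabbasGeorgiouMagenTulsiani2012, Lemma 2.3 (p. 7) and proof of Thm 4.3 with Claim 4.4 (p. 13)] -/
def ofUniformPairs {t : ℕ} (ℒ : LocalExpectations n t)
    (hunif : ∀ S : Finset (Fin n), S.card ≤ 2 → ∀ F : (↥S → Bool) → ℝ,
      ℒ.L S F = (2⁻¹ : ℝ) ^ n * ∑ x : Fin n → Bool, F (S.restrict x)) : SAPlusSolution n t where
  toLocalExpectations := ℒ
  Y := unifMoment n
  psd := unifMoment_posSemidef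
  norm_v0 := by
    rw [unifMoment_apply]
    simp only [indVec, mul_one, sum_const, card_univ, Fintype.card_fun, Fintype.card_bool,
      Fintype.card_fin, nsmul_eq_mul]
    push_cast
    rw [inv_pow]
    exact inv_mul_cancel₀ (by positivity)
  v0_inner i a := by
    rw [unifMoment_apply, hunif {i} (by simp)]
    congr 1
    refine sum_congr rfl fun x _ => ?_
    simp [indVec, Finset.restrict]
  inner i j a c := by
    rw [unifMoment_apply, hunif {i, j} card_le_two]
    congr 1
    refine sum_congr rfl fun x _ => ?_
    simp only [indVec, Finset.restrict]
    by_cases h1 : x i = a <;> by_cases h2 : x j = c <;> simp [h1, h2]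

end SAPlusSolution

/-! ### Claim 3.4: the local distributions on pairs are uniform -/

namespace PairwiseIndependence

variable {k : ℕ} {ι : Type*} {T : ι → Finset (Fin n)}

/-- The boundary of a single constraint is its scope. [cite: Georgiou2010, Def. 8.1.1 (p. 163)] -/
theorem bdry_singleton [DecidableEq ι] (a : ι) : bdry T {a} = T a := by
  ext v
  rw [mem_bdry]
  constructor
  · rintro ⟨i, hi, hv, -⟩
    rw [mem_singleton] at hi
    exact hi ▸ hv
  · intro hv
    exact ⟨a, mem_singleton_self a, hv, fun j hj _ => mem_singleton.1 hj⟩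

/-- The boundary of two constraints contains the symmetric difference of their scopes.
[cite: Georgiou2010, Def. 8.1.1 (p. 163)] -/
theorem sdiff_union_sdiff_subset_bdry_pair [DecidableEq ι] {a b : ι} :
    (T a \ T b) ∪ (T b \ T a) ⊆ bdry T {a, b} := by
  intro v hv
  rw [mem_bdry]
  rcases mem_union.1 hv with h | h
  · rw [mem_sdiff] at h
    refine ⟨a, mem_insert_self a {b}, h.1, fun j hj hvj => ?_⟩
    rcases mem_insert.1 hj with hj | hj
    · exact hj
    · rw [mem_singleton] at hj
      exact absurd (hj ▸ hvj) h.2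
  · rw [mem_sdiff] at h
    refine ⟨b, mem_insert_of_mem (mem_singleton_self b), h.1, fun j hj hvj => ?_⟩
    rcases mem_insert.1 hj with hj | hj
    · exact absurd (hj ▸ hvj) h.2
    · exact mem_singleton.1 hj

/-- **Expansion of `G|_{−S}` for `|S| ≤ 2` under hypothesis (3)** ("no two constraints share more than
one variable"): if all scopes have size `k ≥ 3`, any two meet in at most one variable, and `G` is
`(r, k − 9/4)`-boundary expanding, then for every `S` with `|S| ≤ 2` every family `F` of at most `r`
constraints has `|∂F ∖ S| ≥ (k − 35/12)|F|` (`|F| = 1`: `|∂F| = k`; `|F| = 2`: `|∂F| ≥ 2k − 2`;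
`|F| ≥ 3`: `(k − 9/4)|F| − 2 ≥ (k − 35/12)|F|`).
[cite: BenabbasGeorgiouMagenTulsiani2012, §4 (p. 13: "conditioned on no two constraints sharing more than one variable") and Claim 3.4] [cite: Georgiou2010, Lemma 8.5.1 (3) (p. 174)] -/
theorem expandsOff_pair [Fintype ι] [DecidableEq ι] (hk : 3 ≤ k) (hTcard : ∀ i, (T i).card = k)
    (hsh : ∀ a b : ι, a ≠ b → (T a ∩ T b).card ≤ 1) {r : ℝ}
    (hG : ExpandsOff T ∅ r ((k : ℝ) - 9 / 4)) (S : Finset (Fin n)) (hS : S.card ≤ 2) :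
    ExpandsOff T S r ((k : ℝ) - 35 / 12) := by
  classical
  intro F _ hFr
  have hk3 : (3 : ℝ) ≤ k := by exact_mod_cast hk
  -- global expansion of `F`
  have hglob : ((k : ℝ) - 9 / 4) * F.card ≤ ((bdry T F).card : ℝ) := by
    have h := hG F (fun i _ hsub => by
      have := card_le_card hsub
      rw [hTcard, card_empty] at this
      omega) hFr
    rwa [sdiff_empty] at h
  -- `|∂F ∖ S| ≥ |∂F| − 2`
  have hsd : ((bdry T F).card : ℝ) - 2 ≤ ((bdry T F \ S).card : ℝ) := by
    have h1 : (bdry T F).card ≤ (bdry T F \ S).card + S.card := by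
      have h2 := card_sdiff_add_card_inter (bdry T F) S
      have h3 : (bdry T F ∩ S).card ≤ S.card := card_le_card inter_subset_right
      omega
    have h4 : ((bdry T F).card : ℝ) ≤ (bdry T F \ S).card + S.card := by exact_mod_cast h1
    have hS2 : (S.card : ℝ) ≤ 2 := by exact_mod_cast hS
    linarith
  rcases Nat.lt_or_ge F.card 3 with hlt | hge
  · interval_cases hF : F.card
    · simp
    · -- one constraint: `∂F = T a`, `|T a| = k`
      obtain ⟨a, rfl⟩ := Finset.card_eq_one.1 hF
      have hb : ((bdry T {a}).card : ℝ) = k := by rw [bdry_singleton, hTcard]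
      rw [hb] at hsd
      push_cast
      linarith
    · -- two constraints sharing at most one variable: `|∂F| ≥ 2k − 2`
      obtain ⟨a, b, hab, rfl⟩ := Finset.card_eq_two.1 hF
      have hb : 2 * (k : ℝ) - 2 ≤ ((bdry T {a, b}).card : ℝ) := by
        have hdisj : Disjoint (T a \ T b) (T b \ T a) :=
          Finset.disjoint_left.2 fun v h1 h2 => (mem_sdiff.1 h1).2 (mem_sdiff.1 h2).1
        have h1 := card_le_card (sdiff_union_sdiff_subset_bdry_pair (T := T) (a := a) (b := b))
        rw [card_union_of_disjoint hdisj] at h1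
        have h2 := card_sdiff_add_card_inter (T a) (T b)
        have h3 := card_sdiff_add_card_inter (T b) (T a)
        rw [inter_comm] at h3
        have h4 := hsh a b hab
        have h5 := hTcard a
        have h6 := hTcard b
        have h7 : 2 * k - 2 ≤ (bdry T {a, b}).card := by omega
        have h8 : ((2 * k - 2 : ℕ) : ℝ) ≤ ((bdry T {a, b}).card : ℝ) := by exact_mod_cast h7
        rw [Nat.cast_sub (by omega)] at h8
        push_cast at h8
        exact h8
      push_cast
      linarith
  · -- at least three constraints
    have hf : (3 : ℝ) ≤ F.card := by exact_mod_cast hge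
    nlinarith

/-- For `|S| ≤ 2 < k` no constraint is `S`-dominated. [cite: Georgiou2010, §8.1 (p. 163)] -/
theorem dominated_eq_empty_of_card_le_two [Fintype ι] (hk : 3 ≤ k) (hTcard : ∀ i, (T i).card = k)
    {S : Finset (Fin n)} (hS : S.card ≤ 2) : dominated T S = ∅ := by
  ext i
  simp only [mem_dominated, Finset.notMem_empty, iff_false]
  intro h
  have := card_le_card h
  rw [hTcard] at this
  omega

/-- **Claim 3.4 ("`P_µ(S)` is a balanced pairwise independent distribution"), in the form: for
`|S| ≤ 2`, `S ⊆ W` and `|𝒞(W)| ≤ r`, the local expectation under `P_µ(W)` of a function of `x|_S` is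
its UNIFORM average.**  Proof: Lemma 8.4.2 (`sum_mul_wt_eq`) for `S ⊆ W`, using the expansion of
`G|_{−S}` (`expandsOff_pair`) and `𝒞(S) = ∅`.
[cite: BenabbasGeorgiouMagenTulsiani2012, Claim 3.4 and proof of Thm 4.3 (p. 13)] [cite: Georgiou2010, Lemma 8.4.2 (p. 171)] -/
theorem pE_eq_uniform_of_card_le_two [Fintype ι] [DecidableEq ι] (hk : 3 ≤ k)
    (hTcard : ∀ i, (T i).card = k) (hsh : ∀ a b : ι, a ≠ b → (T a ∩ T b).card ≤ 1)
    (w : ι → (Fin n → Bool) → ℝ)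
    (hw : ∀ i (x y : Fin n → Bool), (∀ j ∈ T i, x j = y j) → w i x = w i y)
    (hstep : ∀ (i : ι) (F : Finset (Fin n)), F ⊆ T i → (T i \ F).card ≤ 2 →
      ∀ h : (Fin n → Bool) → ℝ, (∀ x y : Fin n → Bool, (∀ j, j ∉ F → x j = y j) → h x = h y) →
        ∑ x, h x * w i x = (2⁻¹ : ℝ) ^ k * ∑ x, h x)
    {r : ℕ} (hG : ExpandsOff T ∅ r ((k : ℝ) - 9 / 4)) {S W : Finset (Fin n)} (hS : S.card ≤ 2)
    (hSW : S ⊆ W) (hdom : (dominated T W).card ≤ r) (F : (↥S → Bool) → ℝ) :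
    pE T w W (fun x => F (S.restrict x)) = (2⁻¹ : ℝ) ^ n * ∑ x : Fin n → Bool, F (S.restrict x) := by
  classical
  have hTk : ∀ i, (T i).card ≤ k := fun i => (hTcard i).le
  have hexp := expandsOff_pair hk hTcard hsh hG S hS
  have he₂ : (k : ℝ) - 3 < (k : ℝ) - 35 / 12 := by linarith
  have hdomR : ((dominated T W).card : ℝ) ≤ r := by exact_mod_cast hdom
  have hg : ∀ x y : Fin n → Bool, (∀ j ∈ S, x j = y j) →
      (fun x => F (S.restrict x)) x = (fun x => F (S.restrict x)) y := by
    intro x y hxy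
    simp only
    congr 1
    funext a
    exact hxy a a.2
  have h1 := sum_mul_wt_eq hTk w hw hstep hSW hexp he₂ hdomR (fun x => F (S.restrict x)) hg
  have h2 := sum_mul_wt_eq hTk w hw hstep hSW hexp he₂ hdomR (fun _ => (1 : ℝ)) (fun _ _ _ => rfl)
  have hwtS : ∀ x, wt T w S x = 1 := fun x => by
    rw [wt, dominated_eq_empty_of_card_le_two hk hTcard hS, prod_empty]
  simp only [hwtS, mul_one, one_mul] at h1 h2
  have hc : ((2⁻¹ : ℝ) ^ k) ^ (dominated T W \ dominated T S).card ≠ 0 := by positivity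
  unfold pE
  rw [h1, h2, mul_div_mul_left _ _ hc, sum_const, card_univ, Fintype.card_fun, Fintype.card_bool,
    Fintype.card_fin, nsmul_eq_mul, mul_one]
  push_cast
  rw [inv_pow, div_eq_inv_mul]

/-! ### Lemma 8.5.2 with the domination bound of the advice sets exported -/

/-- **Lemma 8.5.2 (the distributions `D(S) = P_µ(S̄)|_S` are consistent) — the construction of
`exists_localExpectations`, same proof, exporting in addition that the advice set `S̄` dominates at
most `r` constraints** (in the proof: `|𝒞(S̄)| + 4d < r`).
[cite: Georgiou2010, eq. (8.8) and Lemma 8.5.2 (p. 175–176)] [cite: BenabbasGeorgiouMagenTulsiani2012, Claim 4.2] -/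
theorem exists_localExpectations_dom [Fintype ι] [DecidableEq ι] (hk : 3 ≤ k)
    (hTk : ∀ i, (T i).card ≤ k) (hT : ∀ i, (T i).Nonempty) (w : ι → (Fin n → Bool) → ℝ)
    (hw0 : ∀ i x, 0 ≤ w i x)
    (hw : ∀ i (x y : Fin n → Bool), (∀ j ∈ T i, x j = y j) → w i x = w i y)
    (hstep : ∀ (i : ι) (F : Finset (Fin n)), F ⊆ T i → (T i \ F).card ≤ 2 →
      ∀ h : (Fin n → Bool) → ℝ, (∀ x y : Fin n → Bool, (∀ j, j ∉ F → x j = y j) → h x = h y) →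
        ∑ x, h x * w i x = (2⁻¹ : ℝ) ^ k * ∑ x, h x)
    {r d : ℕ} (hG : ExpandsOff T ∅ r ((k : ℝ) - 9 / 4)) (hkd : k ≤ d) (hdr : 16 * k * d ≤ r) :
    ∃ ℒ : LocalExpectations n d, ∀ S : Finset (Fin n), S.card ≤ d →
      ∃ W : Finset (Fin n), S ⊆ W ∧ (∑ x, wt T w W x) ≠ 0 ∧ (dominated T W).card ≤ r ∧
        ∀ F : (↥S → Bool) → ℝ, ℒ.L S F = pE T w W (fun x => F (S.restrict x)) := by
  classical
  have hk3 : (3 : ℝ) ≤ k := by exact_mod_cast hk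
  have hd1 : 1 ≤ d := le_trans (by omega) hkd
  have hd1r : (1 : ℝ) ≤ d := by exact_mod_cast hd1
  have h4dr : 4 * d ≤ r := le_trans (by nlinarith) hdr
  have hdrR : (16 : ℝ) * k * d ≤ r := by exact_mod_cast hdr
  have he₂ : (k : ℝ) - 3 < k - 5 / 2 := by linarith
  -- advice sets
  have hadv : ∀ S : Finset (Fin n), ∃ S' : Finset (Fin n), S ⊆ S' ∧
      (S'.card : ℝ) ≤ (1 + 4 * k) * S.card ∧ ExpandsOff T S' (r - 4 * S.card) ((k : ℝ) - 5 / 2) := by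
    intro S
    obtain ⟨S', h1, h2, h3⟩ := exists_closure (k := k) hTk hT (Nat.cast_nonneg r)
      (show (k : ℝ) - 5 / 2 < k - 9 / 4 by linarith) hG S
    have hq : ((k : ℝ) - 9 / 4 - (k - 5 / 2)) = 1 / 4 := by ring
    rw [hq] at h2 h3
    refine ⟨S', h1, ?_, h3.mono (le_of_eq ?_) le_rfl⟩
    · have : (1 + (k : ℝ) / (1 / 4)) = 1 + 4 * k := by ring
      rw [this] at h2; exact h2
    · ring
  choose adv hadvS hadvC hadvE using hadv
  -- dominated families of small variable sets are small
  have hdomlt : ∀ W : Finset (Fin n), (W.card : ℝ) ≤ (8 * k + 2) * d →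
      (dominated T W).card + 4 * d < r := by
    intro W hW
    have hρ : (((r - 4 * d : ℕ)) : ℝ) ≤ r := by exact_mod_cast Nat.sub_le _ _
    have hcast : (((r - 4 * d : ℕ)) : ℝ) = r - 4 * d := by
      rw [Nat.cast_sub h4dr]; push_cast; ring
    have hW' : (W.card : ℝ) < ((k : ℝ) - 9 / 4) * (((r - 4 * d : ℕ)) : ℝ) := by
      rw [hcast]
      have h1 : (3 : ℝ) / 4 * (r - 4 * d) ≤ ((k : ℝ) - 9 / 4) * (r - 4 * d) :=
        mul_le_mul_of_nonneg_right (by linarith) (by linarith)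
      have h2 : (8 * (k : ℝ) + 2) * d < 3 / 4 * (r - 4 * d) := by nlinarith
      linarith
    have := card_dominated_lt hT hG W hρ hW'
    omega
  -- the partition functions are positive
  have hZ : ∀ W : Finset (Fin n), (W.card : ℝ) ≤ (8 * k + 2) * d → 0 < ∑ x, wt T w W x := by
    intro W hW
    have hdom : ((dominated T W).card : ℝ) ≤ r := by
      have := hdomlt W hW
      exact_mod_cast (by omega : (dominated T W).card ≤ r)
    rw [sum_wt_eq hTk hT w hw hstep (hG.mono le_rfl (by linarith)) he₂ W hdom]
    positivity
  have hadvsmall : ∀ S : Finset (Fin n), S.card ≤ d → ((adv S).card : ℝ) ≤ (8 * k + 2) * d := by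
    intro S hS
    have hS' : (S.card : ℝ) ≤ d := by exact_mod_cast hS
    have hk0 : (0 : ℝ) ≤ 1 + 4 * k := by positivity
    calc ((adv S).card : ℝ) ≤ (1 + 4 * k) * S.card := hadvC S
      _ ≤ (1 + 4 * k) * d := mul_le_mul_of_nonneg_left hS' hk0
      _ ≤ (8 * k + 2) * d := by nlinarith
  -- the functionals
  let Lfun : (S : Finset (Fin n)) → (((↥S → Bool) → ℝ) →ₗ[ℝ] ℝ) := fun S =>
    { toFun := fun F => pE T w (adv S) (fun x => F (S.restrict x))
      map_add' := fun F G => by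
        simp only [pE, Pi.add_apply, add_mul, sum_add_distrib, add_div]
      map_smul' := fun a F => by
        simp only [pE, Pi.smul_apply, smul_eq_mul, RingHom.id_apply, mul_assoc, ← mul_sum,
          mul_div_assoc] }
  refine ⟨⟨Lfun, ?_, ?_, ?_⟩, fun S hS => ⟨adv S, hadvS S, (hZ _ (hadvsmall S hS)).ne', ?_,
    fun F => rfl⟩⟩
  · -- nonnegativity
    intro S _ F hF
    show 0 ≤ pE T w (adv S) (fun x => F (S.restrict x))
    exact div_nonneg (sum_nonneg fun x _ => mul_nonneg (hF _) (wt_nonneg w hw0 _ x))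
      (sum_nonneg fun x _ => wt_nonneg w hw0 _ x)
  · -- normalisation
    intro S hS
    show pE T w (adv S) (fun _ => (1 : ℝ)) = 1
    simp only [pE, one_mul]
    exact div_self (hZ _ (hadvsmall S hS)).ne'
  · -- consistency (Lemma 8.5.2)
    intro Q S hQS hS F
    show pE T w (adv S) (fun x => F (Finset.restrict₂ (π := fun _ => Bool) hQS (S.restrict x))) =
      pE T w (adv Q) (fun x => F (Q.restrict x))
    have hrestr : (fun x : Fin n → Bool =>
        F (Finset.restrict₂ (π := fun _ => Bool) hQS (S.restrict x))) =
        fun x => F (Q.restrict x) := rfl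
    rw [hrestr]
    set g : (Fin n → Bool) → ℝ := fun x => F (Q.restrict x) with hgdef
    have hQ : Q.card ≤ d := (card_le_card hQS).trans hS
    have hgQ : ∀ V : Finset (Fin n), Q ⊆ V → ∀ x y : Fin n → Bool,
        (∀ j ∈ V, x j = y j) → g x = g y := by
      intro V hV x y hxy
      simp only [hgdef]
      congr 1
      funext a
      exact hxy a (hV a.2)
    set S₃ := adv Q ∪ adv S with hS₃
    have hS₃card : ((dominated T S₃).card : ℝ) + 4 * d < r := by
      have h1 : (S₃.card : ℝ) ≤ (8 * k + 2) * d := by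
        have hu : (S₃.card : ℝ) ≤ (adv Q).card + (adv S).card := by
          exact_mod_cast card_union_le _ _
        have hQ' : (Q.card : ℝ) ≤ d := by exact_mod_cast hQ
        have hS' : (S.card : ℝ) ≤ d := by exact_mod_cast hS
        have hk0 : (0 : ℝ) ≤ 1 + 4 * k := by positivity
        calc (S₃.card : ℝ) ≤ (1 + 4 * k) * Q.card + (1 + 4 * k) * S.card := by
              linarith [hadvC Q, hadvC S]
          _ ≤ (1 + 4 * k) * d + (1 + 4 * k) * d := by
              gcongr
          _ = (8 * k + 2) * d := by ring
      exact_mod_cast hdomlt S₃ h1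
    have hdomS : ((dominated T S₃).card : ℝ) ≤ r - 4 * S.card := by
      have : (S.card : ℝ) ≤ d := by exact_mod_cast hS
      linarith
    have hdomQ : ((dominated T S₃).card : ℝ) ≤ r - 4 * Q.card := by
      have : (Q.card : ℝ) ≤ d := by exact_mod_cast hQ
      linarith
    rw [← pE_eq_of_subset hTk w hw hstep (subset_union_right : adv S ⊆ S₃) (hadvE S) he₂ hdomS g
        (hgQ (adv S) (hQS.trans (hadvS S))),
      ← pE_eq_of_subset hTk w hw hstep (subset_union_left : adv Q ⊆ S₃) (hadvE Q) he₂ hdomQ g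
        (hgQ (adv Q) (hadvS Q))]
  · -- the exported domination bound
    have := hdomlt (adv S) (hadvsmall S hS)
    omega

/-! ### The SDP half of Theorem 4.3 for one instance -/

/-- **[BGMT12] Thm 4.3, SDP half, for ONE expanding instance satisfying hypothesis (3):** with scopes
`T_i = e_i(Fin k)` (`k ≥ 3`) pairwise meeting in at most one variable, a balanced pairwise
independent `µ`, `G` `(r, k − 9/4)`-boundary expanding, `k ≤ d` and `16kd ≤ r`, there is a
level-`d` Sherali–Adams SDP (`SA₊`) solution — the local distributions `D(S) = P_µ(S̄)|_S` of
Lemma 8.5.2 (uniform on pairs by Claim 3.4) with the vectors of Claim 4.4 — whose Sherali–Adams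
functional gives value exactly `1` to every `T_i`-junta equal to `1` on `{µ_i ≠ 0}` (e.g. the
indicator of the `i`-th constraint of a promising predicate supported by `µ`).
[cite: BenabbasGeorgiouMagenTulsiani2012, Thm 4.3 (proof, p. 13) with Lemma 2.3, Claim 3.4, Claim 4.4] [cite: Georgiou2010, Thm 8.5.3 (p. 176–177)] -/
theorem exists_saPlusSolution_lits [Fintype ι] [DecidableEq ι] (hk : 3 ≤ k)
    {μ : (Fin k → Bool) → ℝ} (hμ : IsBalancedPairwiseIndependent μ) (e : ι → (Fin k ↪ Fin n))
    (p : ι → Fin k → Bool)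
    (hsh : ∀ a b : ι, a ≠ b →
      (((univ : Finset (Fin k)).map (e a)) ∩ ((univ : Finset (Fin k)).map (e b))).card ≤ 1)
    {r d : ℕ}
    (hG : ExpandsOff (fun i => (univ : Finset (Fin k)).map (e i)) ∅ r ((k : ℝ) - 9 / 4))
    (hkd : k ≤ d) (hdr : 16 * k * d ≤ r) :
    ∃ Λ : SAPlusSolution n d, ∀ (i : ι) (f : (Fin n → Bool) → ℝ),
      (∀ x y : Fin n → Bool, (∀ j ∈ (univ : Finset (Fin k)).map (e i), x j = y j) → f x = f y) →
      (∀ x, litWeight μ (e i) (p i) x ≠ 0 → f x = 1) → Λ.saE f = 1 := by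
  classical
  have hk0 : 0 < k := by omega
  set T : ι → Finset (Fin n) := fun i => (univ : Finset (Fin k)).map (e i) with hT
  have hTcard : ∀ i, (T i).card = k := fun i => by
    simp only [hT, card_map, card_univ, Fintype.card_fin]
  have hTk : ∀ i, (T i).card ≤ k := fun i => (hTcard i).le
  have hTne : ∀ i, (T i).Nonempty := fun i => ⟨e i ⟨0, hk0⟩, mem_map_of_mem _ (mem_univ _)⟩
  set w : ι → (Fin n → Bool) → ℝ := fun i => litWeight μ (e i) (p i) with hw
  have hw0 : ∀ i x, 0 ≤ w i x := fun i x => hμ.nonneg _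
  have hwc : ∀ i (x y : Fin n → Bool), (∀ j ∈ T i, x j = y j) → w i x = w i y :=
    fun i x y hxy => litWeight_congr μ (e i) (p i) hxy
  have hstep : ∀ (i : ι) (F : Finset (Fin n)), F ⊆ T i → (T i \ F).card ≤ 2 →
      ∀ h : (Fin n → Bool) → ℝ, (∀ x y : Fin n → Bool, (∀ j, j ∉ F → x j = y j) → h x = h y) →
        ∑ x, h x * w i x = (2⁻¹ : ℝ) ^ k * ∑ x, h x :=
    fun i F _ hF h hh => sum_mul_litWeight_eq hk0 hμ (e i) (p i) F hF h hh
  obtain ⟨ℒ, hℒ⟩ := exists_localExpectations_dom (T := T) hk hTk hTne w hw0 hwc hstep hG hkd hdr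
  -- Claim 3.4: the distributions on pairs are uniform
  have hunif : ∀ S : Finset (Fin n), S.card ≤ 2 → ∀ F : (↥S → Bool) → ℝ,
      ℒ.L S F = (2⁻¹ : ℝ) ^ n * ∑ x : Fin n → Bool, F (S.restrict x) := by
    intro S hS F
    obtain ⟨W, hSW, -, hdom, hLW⟩ := hℒ S (hS.trans (by omega))
    rw [hLW F]
    exact pE_eq_uniform_of_card_le_two hk hTcard hsh w hwc hstep hG hS hSW hdom F
  refine ⟨SAPlusSolution.ofUniformPairs ℒ hunif, fun i f hf hf1 => ?_⟩
  -- the value of a constraint, as in `exists_saPseudoexpectation`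
  change ℒ.saE f = 1
  have hTi : (T i).card ≤ d := (hTk i).trans hkd
  obtain ⟨W, hTW, hZ, -, hL⟩ := hℒ (T i) hTi
  rw [ℒ.saE_eq_of_dependsOn hTi hf, hL]
  have hext : (fun x : Fin n → Bool =>
      f (LocalExpectations.extend (T i) ((T i).restrict x))) = f := by
    funext x
    exact (LocalExpectations.eq_extend_restrict_of_dependsOn hf x).symm
  rw [hext]
  unfold pE
  have hnum : ∑ x, f x * wt T w W x = ∑ x, wt T w W x := by
    refine sum_congr rfl fun x _ => ?_
    by_cases hx : wt T w W x = 0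
    · rw [hx, mul_zero]
    · have hi : i ∈ dominated T W := mem_dominated.2 hTW
      have hwi : w i x ≠ 0 := (prod_ne_zero_iff.1 hx) i hi
      rw [hf1 x hwi, one_mul]
  rw [hnum]
  exact div_self hZ

end PairwiseIndependence

end Literature.Combinatorics.Optimization

end
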